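import Literature.MathematicalPhysics.QuantumFieldTheory.SUNBakryEmeryQuadratic
import HarnessLib

/-!
# The one-link Poincaré inequality on `SU(N)` under a curvature–dimension bound: Lipschitz and
# variance forms

`SUNBakryEmeryCurvature.lean` (`SUNBakryEmery.poincare_of_curvature`) generalises the Bakry–Émery
Poincaré inequality of `SUNBakryEmeryPoincare.lean` from the linear one-link tilt `c Re tr(Q B)` to an
ARBITRARY smooth potential `S : M_N(ℂ) → ℝ` under the pointwise curvature–dimension hypothesis
`K Γ(u,u) ≤ Γ₂^S(u)` on `SU(N)` (hypothesis `hCD`), for SMOOTH test functions `u`.  This file adds the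
forms in which the inequality is consumed by Dobrushin-type perturbation arguments
(`abs_integral_tilted_add_sub_le`) and by variance bounds for Lipschitz observables:

* `poincare_of_CD` — the smooth form (a restatement of `poincare_of_curvature` under this file's
  historical name);
* `integral_exp_mul_sub_sq_le_of_CD` — `K ∫ e^S (ψ - m_ψ)² dσ ≤ M² ∫ e^S dσ` for every `ψ` with
  `|ψ(a) - ψ(b)| ≤ M ‖a - b‖_F` (smooth approximation of Lipschitz functions, `Γ ≤ M²`);
* `variance_tilted_le_of_CD` — `Var_{σ^S}(ψ) ≤ M² / K` for the tilted Haar probability measure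
  `σ^S = e^S σ / ∫ e^S dσ` (`Measure.tilted`): the general-potential version of `haarPoincare_SU`;
* `integral_sub_sq_tilted_le_of_CD` — the same in the integral form `∫ (ψ - ∫ ψ dσ^S)² dσ^S ≤ M²/K`
  (the shape of hypothesis `hP` of `abs_integral_tilted_add_sub_le`);
* `Gam2_ge_of_hessBound` — the curvature hypothesis from a two-sided frame Hessian bound
  (`Gam2_ge_of_hess_le` of `SUNBakryEmeryQuadratic.lean` quantified over `u` and `g`).

(History: the first revision of this file re-derived the whole engine independently and
simultaneously with `SUNBakryEmeryCurvature.lean`; this revision keeps only what is not there.)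

## References

* D. Bakry, M. Émery, *Diffusions hypercontractives*, Sém. Probab. XIX, LNM 1123 (1985) 177–206.
* D. Bakry, I. Gentil, M. Ledoux, *Analysis and Geometry of Markov Diffusion Operators*,
  Grundlehren 348 (2014), §4.8 (Prop. 4.8.1).
* H. Shen, R. Zhu, X. Zhu, CMP 400 (2023) 805–851, arXiv:2204.12737, (4.7)–(4.8), Cor. 4.4 (4.11).
-/

noncomputable section

open scoped Matrix ComplexConjugate BigOperators

namespace Literature.MathematicalPhysics.QuantumFieldTheory

namespace SUNBakryEmery

open scoped Matrix.Norms.Frobenius ContDiff Topology InnerProductSpace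
open Matrix Complex Finset MeasureTheory Filter ProbabilityTheory

variable {N : ℕ}

/-! ### The curvature–dimension hypothesis and the integrated Bochner inequality -/

/-- **Bakry–Émery condition from a frame Hessian bound**: if the Hessian term of Bochner's formula
satisfies `|∑_{αβ} D_αu D_βu D_αD_βS (Q)| ≤ L Γ(u,u)(Q)` on `SU(N)`, then
`Γ₂^S(u) ≥ (N/2 - L) Γ(u,u)` there (`Ric_{SU(N)} = N/2`, Bakry–Émery `CD(N/2 - L, ∞)`). [cite: arXiv220412737, (4.7)-(4.8) (p. 19)] -/
theorem Gam2_ge_of_hessBound (hN : N ≠ 0) {S : Matrix (Fin N) (Fin N) ℂ → ℝ} (hS : ContDiff ℝ ∞ S)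
    {L : ℝ}
    (hHess : ∀ u : Matrix (Fin N) (Fin N) ℂ → ℝ, ContDiff ℝ ∞ u → ∀ g : SUN N,
      |∑ α, ∑ β, matD (frame α) u g * matD (frame β) u g * matD (frame α) (matD (frame β) S) g| ≤
        L * Gam u u g)
    {u : Matrix (Fin N) (Fin N) ℂ → ℝ} (hu : ContDiff ℝ ∞ u) (g : SUN N) :
    ((N : ℝ) / 2 - L) * Gam u u g ≤ Gam2 S u g :=
  Gam2_ge_of_hess_le hN hS hu (abs_le.1 (hHess u hu g)).2

/-- **Integrated curvature–dimension inequality**: under `Γ₂^S(u) ≥ K Γ(u,u)` on `SU(N)`,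
`K ∫ e^S Γ(u,u) dσ ≤ ∫ e^S (L_S u)² dσ` (integrated Bochner formula). [cite: arXiv220412737, (4.7) (p. 19)] -/
theorem integral_exp_mul_Gam_le_of_CD (hN : N ≠ 0) {S : Matrix (Fin N) (Fin N) ℂ → ℝ}
    (hS : ContDiff ℝ ∞ S) {K : ℝ}
    (hCD : ∀ u : Matrix (Fin N) (Fin N) ℂ → ℝ, ContDiff ℝ ∞ u → ∀ g : SUN N,
      K * Gam u u g ≤ Gam2 S u g)
    {u : Matrix (Fin N) (Fin N) ℂ → ℝ} (hu : ContDiff ℝ ∞ u) :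
    K * ∫ g : SUN N, Real.exp (S g) * Gam u u g ∂(haarProbability (SUN N)) ≤
      ∫ g : SUN N, Real.exp (S g) * genL S u g ^ 2 ∂(haarProbability (SUN N)) :=
  integral_exp_mul_Gam_le_of_curvature hN hS K hCD hu

/-! ### Poincaré from approximate solvability of the Poisson equation -/

/-- **Poincaré inequality from approximate solvability of the Poisson equation** for a general
smooth potential `S` with `Γ₂^S ≥ K Γ`, `K > 0`: if there are smooth `v_k` with
`∫ e^S (L_S v_k - (u - m))² dσ → 0`, then `K ∫ e^S (u - m)² dσ ≤ ∫ e^S Γ(u,u) dσ` (duality,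
Cauchy–Schwarz and the integrated Bochner inequality). [cite: BakryGentilLedoux2014, Prop. 4.8.1] -/
theorem poincare_of_approx_of_CD (hN : N ≠ 0) {S : Matrix (Fin N) (Fin N) ℂ → ℝ}
    (hS : ContDiff ℝ ∞ S) {K : ℝ} (hK : 0 < K)
    (hCD : ∀ u : Matrix (Fin N) (Fin N) ℂ → ℝ, ContDiff ℝ ∞ u → ∀ g : SUN N,
      K * Gam u u g ≤ Gam2 S u g)
    {u : Matrix (Fin N) (Fin N) ℂ → ℝ} (hu : ContDiff ℝ ∞ u) (m : ℝ)
    (v : ℕ → Matrix (Fin N) (Fin N) ℂ → ℝ) (hv : ∀ k, ContDiff ℝ ∞ (v k))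
    (hconv : Tendsto (fun k => ∫ g : SUN N, Real.exp (S g) *
      (genL S (v k) g - (u g - m)) ^ 2 ∂(haarProbability (SUN N))) atTop (𝓝 0)) :
    K * ∫ g : SUN N, Real.exp (S g) * (u g - m) ^ 2 ∂(haarProbability (SUN N)) ≤
      ∫ g : SUN N, Real.exp (S g) * Gam u u g ∂(haarProbability (SUN N)) :=
  poincare_of_approx_of_curvature hN hS hK hCD hu m v hv hconv

/-! ### The Poincaré inequality under the curvature–dimension hypothesis -/

/-- **The Bakry–Émery Poincaré inequality on `SU(N)` for a general smooth potential** (smooth form;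
the statement of `poincare_of_curvature`, kept under this name for the Lipschitz forms below): if
`Γ₂^S(u) ≥ K Γ(u,u)` on `SU(N)` for all smooth `u`, with `K > 0`, then for smooth `u`
`K ∫ e^S (u - m)² dσ ≤ ∫ e^S Γ(u,u) dσ`, `m` the `e^S σ`-mean of `u`
(`CD(K,∞) ⇒ Poincaré(1/K)`). [cite: BakryGentilLedoux2014, Prop. 4.8.1] -/
theorem poincare_of_CD (hN : N ≠ 0) {S : Matrix (Fin N) (Fin N) ℂ → ℝ} (hS : ContDiff ℝ ∞ S)
    {K : ℝ} (hK : 0 < K)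
    (hCD : ∀ u : Matrix (Fin N) (Fin N) ℂ → ℝ, ContDiff ℝ ∞ u → ∀ g : SUN N,
      K * Gam u u g ≤ Gam2 S u g)
    {u : Matrix (Fin N) (Fin N) ℂ → ℝ} (hu : ContDiff ℝ ∞ u) :
    K * ∫ g : SUN N, Real.exp (S g) * (u g -
          (∫ g : SUN N, Real.exp (S g) * u g ∂(haarSU N)) /
            (∫ g : SUN N, Real.exp (S g) ∂(haarSU N))) ^ 2 ∂(haarSU N) ≤
      ∫ g : SUN N, Real.exp (S g) * Gam u u g ∂(haarSU N) :=
  poincare_of_curvature hN hS hK hCD hu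

/-- **The Poincaré inequality in the Lipschitz form, unnormalised**: under `Γ₂^S ≥ K Γ` with
`K > 0`, for every `ψ : SU(N) → ℝ` with `|ψ(a) - ψ(b)| ≤ M ‖a - b‖_F`,
`K ∫ e^S (ψ - m_ψ)² dσ ≤ M² ∫ e^S dσ` where `m_ψ = (∫ e^S ψ dσ)/(∫ e^S dσ)` (smooth
approximation of Lipschitz functions with `Γ ≤ M²`). [cite: BakryGentilLedoux2014, Prop. 4.8.1] -/
theorem integral_exp_mul_sub_sq_le_of_CD (hN : N ≠ 0) {S : Matrix (Fin N) (Fin N) ℂ → ℝ}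
    (hS : ContDiff ℝ ∞ S) {K : ℝ} (hK : 0 < K)
    (hCD : ∀ u : Matrix (Fin N) (Fin N) ℂ → ℝ, ContDiff ℝ ∞ u → ∀ g : SUN N,
      K * Gam u u g ≤ Gam2 S u g)
    (ψ : SUN N → ℝ) {M : ℝ} (hM : 0 ≤ M) (hψ : ∀ a b, |ψ a - ψ b| ≤ M * suFrobDist a b) :
    K * ∫ g : SUN N, Real.exp (S g) * (ψ g -
          (∫ g : SUN N, Real.exp (S g) * ψ g ∂(haarSU N)) /
            (∫ g : SUN N, Real.exp (S g) ∂(haarSU N))) ^ 2 ∂(haarSU N) ≤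
      M ^ 2 * ∫ g : SUN N, Real.exp (S g) ∂(haarSU N) := by
  have hN0 : (0 : ℝ) < N := Nat.cast_pos.2 (Nat.pos_of_ne_zero hN)
  have hSc : Continuous fun g : SUN N => S g := continuous_restrict hS
  have hwc : Continuous fun g : SUN N => Real.exp (S g) := Real.continuous_exp.comp hSc
  have hKpos := hK
  set Z : ℝ := ∫ g : SUN N, Real.exp (S g) ∂(haarSU N) with hZ
  have hZpos : 0 < Z := integral_exp_pos (integrable_of_continuous_SUN hwc _)
  have hψc : Continuous ψ := continuous_of_lipschitz_suFrobDist hψ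
  set m : ℝ := (∫ g : SUN N, Real.exp (S g) * ψ g ∂(haarSU N)) / Z with hmdef
  rw [mul_comm K]
  -- bounds for `ψ`
  obtain ⟨D, hD⟩ : ∃ D, ∀ g : SUN N, |ψ g| ≤ D := by
    obtain ⟨D, hD⟩ := (isCompact_univ (X := SUN N)).exists_bound_of_continuousOn hψc.continuousOn
    exact ⟨D, fun g => (Real.norm_eq_abs _).symm.le.trans (hD g (Set.mem_univ _))⟩
  have hD0 : 0 ≤ D := (abs_nonneg _).trans (hD 1)
  have hwint : ∀ {f : SUN N → ℝ}, Continuous f →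
      Integrable (fun g : SUN N => Real.exp (S g) * f g) (haarSU N) :=
    fun hf => integrable_of_continuous_SUN (hwc.mul hf) _
  -- weighted averages are bounded by sup norms
  have havg : ∀ {f : SUN N → ℝ} (_ : Continuous f) {C : ℝ}, (∀ g, |f g| ≤ C) →
      |(∫ g : SUN N, Real.exp (S g) * f g ∂(haarSU N)) / Z| ≤ C := by
    intro f hf C hC
    rw [abs_div, abs_of_pos hZpos, div_le_iff₀ hZpos]
    calc |∫ g : SUN N, Real.exp (S g) * f g ∂(haarSU N)|
        ≤ ∫ g : SUN N, |Real.exp (S g) * f g| ∂(haarSU N) := abs_integral_le_integral_abs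
      _ ≤ ∫ g : SUN N, Real.exp (S g) * C ∂(haarSU N) := by
          refine integral_mono (hwint hf).abs (hwint continuous_const) fun g => ?_
          rw [abs_mul, abs_of_pos (Real.exp_pos _)]
          exact mul_le_mul_of_nonneg_left (hC g) (Real.exp_pos _).le
      _ = C * Z := by rw [integral_mul_const, hZ, mul_comm]
  have hm : |m| ≤ D := havg hψc hD
  -- the ε-argument
  refine le_of_forall_pos_le_add fun δ hδ => ?_
  have hden : 0 < 2 * (4 * D + 2) * Z * K + 1 := by positivity
  set ε : ℝ := min 1 (δ / (2 * (4 * D + 2) * Z * K + 1)) with hεdef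
  have hε : 0 < ε := lt_min one_pos (div_pos hδ hden)
  have hε1 : ε ≤ 1 := min_le_left _ _
  have hεδ : 2 * ε * (4 * D + 2) * Z * K ≤ δ := by
    have h1 : ε ≤ δ / (2 * (4 * D + 2) * Z * K + 1) := min_le_right _ _
    rw [le_div_iff₀ hden] at h1
    nlinarith [hZpos, hD0, hε, hKpos]
  obtain ⟨F, hF, hΓF, hFψ⟩ := exists_smooth_approx hM hψ hε hN
  have hFc : Continuous fun g : SUN N => F g := continuous_restrict hF
  -- Poincaré for `F`
  set mF : ℝ := (∫ g : SUN N, Real.exp (S g) * F g ∂(haarSU N)) / Z with hmFdef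
  have hPF : K * ∫ g : SUN N, Real.exp (S g) * (F g - mF) ^ 2 ∂(haarSU N) ≤ M ^ 2 * Z := by
    have h := poincare_of_CD hN hS hK hCD hF
    refine h.trans ?_
    calc ∫ g : SUN N, Real.exp (S g) * Gam F F g ∂(haarSU N)
        ≤ ∫ g : SUN N, Real.exp (S g) * M ^ 2 ∂(haarSU N) := by
          refine integral_mono (hwint (continuous_restrict (contDiff_Gam hF hF)))
            (hwint continuous_const) fun g => ?_
          exact mul_le_mul_of_nonneg_left (hΓF g) (Real.exp_pos _).le
      _ = M ^ 2 * Z := by rw [integral_mul_const, hZ, mul_comm]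
  -- compare `ψ - m` with `F - mF`
  have hmm : |mF - m| ≤ ε := by
    have h : mF - m = (∫ g : SUN N, Real.exp (S g) * (F g - ψ g) ∂(haarSU N)) / Z := by
      rw [hmFdef, hmdef, ← sub_div, ← integral_sub (hwint hFc) (hwint hψc)]
      congr 1
      exact integral_congr_ae (ae_of_all _ fun g => by ring)
    rw [h]
    exact havg (hFc.sub hψc) fun g => hFψ g
  have hpt : ∀ g : SUN N, Real.exp (S g) * (ψ g - m) ^ 2 ≤
      Real.exp (S g) * (F g - mF) ^ 2 + Real.exp (S g) * (2 * ε * (4 * D + 2)) := by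
    intro g
    rw [← mul_add]
    refine mul_le_mul_of_nonneg_left ?_ (Real.exp_pos _).le
    have ha : |ψ g - m| ≤ 2 * D := by
      have := abs_sub (ψ g) m
      linarith [hD g, hm]
    have hab : |(ψ g - m) - (F g - mF)| ≤ 2 * ε := by
      have e : (ψ g - m) - (F g - mF) = -(F g - ψ g) + (mF - m) := by ring
      rw [e]
      refine (abs_add_le _ _).trans ?_
      rw [abs_neg]
      linarith [hFψ g, hmm]
    have hb : |F g - mF| ≤ 2 * D + 2 * ε := by
      have h1 := abs_sub_abs_le_abs_sub (F g - mF) (ψ g - m)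
      have h2 : |(F g - mF) - (ψ g - m)| ≤ 2 * ε := by rw [abs_sub_comm]; exact hab
      linarith
    have key : (ψ g - m) ^ 2 - (F g - mF) ^ 2 ≤ 2 * ε * (4 * D + 2) := by
      have e : (ψ g - m) ^ 2 - (F g - mF) ^ 2 =
          ((ψ g - m) - (F g - mF)) * ((ψ g - m) + (F g - mF)) := by ring
      rw [e]
      refine (le_abs_self _).trans ?_
      rw [abs_mul]
      have hsum : |(ψ g - m) + (F g - mF)| ≤ 4 * D + 2 := by
        refine (abs_add_le _ _).trans ?_
        nlinarith [ha, hb, hε1]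
      calc |ψ g - m - (F g - mF)| * |ψ g - m + (F g - mF)| ≤ (2 * ε) * (4 * D + 2) :=
            mul_le_mul hab hsum (abs_nonneg _) (by positivity)
        _ = 2 * ε * (4 * D + 2) := by ring
    linarith
  have j0 : Integrable (fun g : SUN N => Real.exp (S g) * (ψ g - m) ^ 2) (haarSU N) :=
    hwint ((hψc.sub continuous_const).pow 2)
  have j1 : Integrable (fun g : SUN N => Real.exp (S g) * (F g - mF) ^ 2) (haarSU N) :=
    hwint ((hFc.sub continuous_const).pow 2)
  have j2 : Integrable (fun g : SUN N => Real.exp (S g) * (2 * ε * (4 * D + 2))) (haarSU N) :=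
    hwint continuous_const
  have j12 : Integrable (fun g : SUN N => Real.exp (S g) * (F g - mF) ^ 2 +
      Real.exp (S g) * (2 * ε * (4 * D + 2))) (haarSU N) := j1.add j2
  have hmono : ∫ g : SUN N, Real.exp (S g) * (ψ g - m) ^ 2 ∂(haarSU N) ≤
      ∫ g : SUN N, (Real.exp (S g) * (F g - mF) ^ 2 +
        Real.exp (S g) * (2 * ε * (4 * D + 2))) ∂(haarSU N) :=
    integral_mono j0 j12 hpt
  have hsplit : ∫ g : SUN N, (Real.exp (S g) * (F g - mF) ^ 2 +
      Real.exp (S g) * (2 * ε * (4 * D + 2))) ∂(haarSU N) =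
      ∫ g : SUN N, Real.exp (S g) * (F g - mF) ^ 2 ∂(haarSU N) + Z * (2 * ε * (4 * D + 2)) := by
    rw [integral_add j1 j2, integral_mul_const]
  have h1 : (∫ g : SUN N, Real.exp (S g) * (F g - mF) ^ 2 ∂(haarSU N)) * K ≤ M ^ 2 * Z := by
    rw [mul_comm]; exact hPF
  have h2 : Z * (2 * ε * (4 * D + 2)) * K ≤ δ := by
    calc Z * (2 * ε * (4 * D + 2)) * K = 2 * ε * (4 * D + 2) * Z * K := by ring
      _ ≤ δ := hεδ
  calc (∫ g : SUN N, Real.exp (S g) * (ψ g - m) ^ 2 ∂(haarSU N)) * K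
      ≤ (∫ g : SUN N, Real.exp (S g) * (F g - mF) ^ 2 ∂(haarSU N) +
          Z * (2 * ε * (4 * D + 2))) * K := by
        rw [← hsplit]; exact mul_le_mul_of_nonneg_right hmono hKpos.le
    _ = (∫ g : SUN N, Real.exp (S g) * (F g - mF) ^ 2 ∂(haarSU N)) * K +
          Z * (2 * ε * (4 * D + 2)) * K := add_mul _ _ _
    _ ≤ M ^ 2 * Z + δ := add_le_add h1 h2

/-- **The one-link Poincaré inequality in the variance form** for a general smooth potential with
`Γ₂^S ≥ K Γ`, `K > 0`: `Var_{σ^S}(ψ) ≤ M² / K` for the tilted Haar probability measure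
`σ^S = e^S σ / ∫ e^S dσ` and every `ψ` with `|ψ(a) - ψ(b)| ≤ M ‖a - b‖_F`. [cite: BakryGentilLedoux2014, Prop. 4.8.1] -/
theorem variance_tilted_le_of_CD (hN : N ≠ 0) {S : Matrix (Fin N) (Fin N) ℂ → ℝ}
    (hS : ContDiff ℝ ∞ S) {K : ℝ} (hK : 0 < K)
    (hCD : ∀ u : Matrix (Fin N) (Fin N) ℂ → ℝ, ContDiff ℝ ∞ u → ∀ g : SUN N,
      K * Gam u u g ≤ Gam2 S u g)
    (ψ : SUN N → ℝ) {M : ℝ} (hM : 0 ≤ M) (hψ : ∀ a b, |ψ a - ψ b| ≤ M * suFrobDist a b) :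
    Var[ψ; (haarSU N).tilted fun g => S g] ≤ M ^ 2 / K := by
  have hSc : Continuous fun g : SUN N => S g := continuous_restrict hS
  have hwc : Continuous fun g : SUN N => Real.exp (S g) := Real.continuous_exp.comp hSc
  set Z : ℝ := ∫ g : SUN N, Real.exp (S g) ∂(haarSU N) with hZ
  have hZpos : 0 < Z := integral_exp_pos (integrable_of_continuous_SUN hwc _)
  have hψc : Continuous ψ := continuous_of_lipschitz_suFrobDist hψ
  set m : ℝ := (∫ g : SUN N, Real.exp (S g) * ψ g ∂(haarSU N)) / Z with hmdef
  have hmean : ∫ g, ψ g ∂((haarSU N).tilted fun g => S g) = m := by rw [integral_tilted_eq_div]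
  have hvar : Var[ψ; (haarSU N).tilted fun g => S g] =
      (∫ g : SUN N, Real.exp (S g) * (ψ g - m) ^ 2 ∂(haarSU N)) / Z := by
    rw [ProbabilityTheory.variance_eq_integral hψc.aemeasurable, hmean, integral_tilted_eq_div]
  rw [hvar, div_le_div_iff₀ hZpos hK, mul_comm _ K]
  exact integral_exp_mul_sub_sq_le_of_CD hN hS hK hCD ψ hM hψ

/-- **The one-link Poincaré inequality in the integral form** (the shape of hypothesis `hP` of the
perturbation lemma `abs_integral_tilted_add_sub_le`): under `Γ₂^S ≥ K Γ`, `K > 0`,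
`∫ (ψ - ∫ ψ dσ^S)² dσ^S ≤ M² / K` for every `ψ` with `|ψ(a) - ψ(b)| ≤ M ‖a - b‖_F`. [cite: BakryGentilLedoux2014, Prop. 4.8.1] -/
theorem integral_sub_sq_tilted_le_of_CD (hN : N ≠ 0) {S : Matrix (Fin N) (Fin N) ℂ → ℝ}
    (hS : ContDiff ℝ ∞ S) {K : ℝ} (hK : 0 < K)
    (hCD : ∀ u : Matrix (Fin N) (Fin N) ℂ → ℝ, ContDiff ℝ ∞ u → ∀ g : SUN N,
      K * Gam u u g ≤ Gam2 S u g)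
    (ψ : SUN N → ℝ) {M : ℝ} (hM : 0 ≤ M) (hψ : ∀ a b, |ψ a - ψ b| ≤ M * suFrobDist a b) :
    ∫ g, (ψ g - ∫ g', ψ g' ∂((haarSU N).tilted fun g => S g)) ^ 2
        ∂((haarSU N).tilted fun g => S g) ≤ M ^ 2 / K := by
  have hψc : Continuous ψ := continuous_of_lipschitz_suFrobDist hψ
  have h := variance_tilted_le_of_CD hN hS hK hCD ψ hM hψ
  rwa [ProbabilityTheory.variance_eq_integral hψc.aemeasurable] at h

end SUNBakryEmery

end Literature.MathematicalPhysics.QuantumFieldTheory
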